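import Summits.CriticalPhenomena.PercolationContinuityZ3.Theorems.SahiMasterFamilyRigidityR3
import Summits.CriticalPhenomena.PercolationContinuityZ3.Theorems.SahiMasterFamilySharedCoordinate

/-!
# The rigidity detector for triples: a doubly-shared coordinate with a non-trivial pivot structure forces `E_3 ≢ 0`

Support file of the master-family programme (crux `NoHeavyLowerTail`, stmt-CriticalPhenomena-4575; cell `prim-masterthm`, seat P4,
unit `prim-masterthm-p4-g7`).  Seat document HOME/prim-masterthm-p4/EQI3-RIGIDITY-PROOF.md §2–§4.

Combines `SahiMasterFamilySharedCoordinate` (the `p_e²`-coefficient of `E_3(μ_{p[e↦s]}; 1_{U_0},1_{U_1},1_{U_2})` for `U_0` `e`-free is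
`topCoeff`) with THEOREM R₃ (`SahiMasterFamilyRigidityR3.rigidity_three`):

* `identity_of_forall_sahiE_three_eq_zero` — if `E_3(μ_p; 1_U) = 0` for every interior `p` then the R₃-identity holds for
  `(Piv_e U_1, Piv_e U_2, U_0)`;
* **`exists_interior_sahiE_three_ne_zero_of_witness`** — THE RIGIDITY DETECTOR: if `U_0, U_1, U_2` are increasing, `U_0` is `e`-free, nonempty
  and not sure, `e` is pivotal for `U_1` and for `U_2`, and the pivot structure at `e` is NON-TRIVIAL — some coordinate is essential for both
  `Piv_e U_1` and `U_0`, and `Piv_e U_1` meets `U_0` — then `E_3(μ_p; 1_U) ≠ 0` for some interior `p`.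
  By LEMMA M-tri of EQI3-RIGIDITY-PROOF §4 (paper) every triangle-type triple has such a witness, which with the tree's Theorem R, (T-a) and
  Lemma P gives the classification-free proof of (T) = (EQI-3) (itself prim-master-conj's Lean theorem `masterFamilyIdentEqIff_three`).
HONEST FRAMING: a criterion for NON-vanishing of `E_3`; Sahi `C_3` / Kahn's Conj. 5 remain OPEN.  [this work]
-/

noncomputable section

open scoped Classical
open Polynomial

namespace Summit.CriticalPhenomena.PercolationContinuityZ3.Theorems

open Finset Function
open Literature.Combinatorics.Sahi2008
open Literature.Probability.Percolation.DecisionTree (ind ind_of_mem ind_of_not_mem ind_nonneg)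
open SharedCoordinate RigidityR3

namespace TriangleDetector

variable {ι : Type*} [Fintype ι]

/-- `topCoeff` at `n = 1` unfolded: `−[E'(1_{Piv₁}1_{U₀})E'(1_{Piv₂}) + E'(1_{Piv₂}1_{U₀})E'(1_{Piv₁}) − E'(1_{U₀})E'(1_{Piv₁})E'(1_{Piv₂})]`. [this work] -/
theorem topCoeff_one (p : ι → unitInterval) (e : ι) (U : Fin 3 → Set (Set ι)) :
    topCoeff p e U = -((offEx p e (ind (pivSet e (U 1)) * ind (U 0)) * offEx p e (ind (pivSet e (U 2))) +
      offEx p e (ind (pivSet e (U 2)) * ind (U 0)) * offEx p e (ind (pivSet e (U 1)))) -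
      offEx p e (ind (U 0)) * (offEx p e (ind (pivSet e (U 1))) * offEx p e (ind (pivSet e (U 2))))) := by
  unfold topCoeff
  have h0 : (univ : Finset (Fin (1 + 1))).erase 0 = {1} := by decide
  have h1 : (univ : Finset (Fin (1 + 1))).erase 1 = {0} := by decide
  rw [Fin.sum_univ_succ, Fin.sum_univ_succ, Fin.sum_univ_zero, Fin.prod_univ_succ, Fin.prod_univ_succ, Fin.prod_univ_zero]
  simp only [Fin.succ_zero_eq_one, Fin.succ_one_eq_two, h0, h1, prod_singleton]
  ring

/-- **`E_3 ≡ 0` on the open cube forces the R₃-identity for `(Piv_e U_1, Piv_e U_2, U_0)`** (`U_0` `e`-free, `U_1, U_2` increasing). [this work] -/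
theorem identity_of_forall_sahiE_three_eq_zero (U : Fin 3 → Set (Set ι)) (e : ι) (hU0 : ∀ ω, insert e ω ∈ U 0 ↔ ω ∈ U 0)
    (hU : ∀ j : Fin 2, IsUpperSet (U j.succ))
    (hzero : ∀ p : ι → unitInterval, (∀ i, (p i : ℝ) ∈ Set.Ioo (0 : ℝ) 1) → sahiE (bernoulliWeight p) 3 (fun j => ind (U j)) = 0) :
    Identity (pivSet e (U 1)) (pivSet e (U 2)) (U 0) := by
  intro p hp
  -- the polynomial in `s = p_e` vanishes at the three interior grid points, hence is zero
  obtain ⟨Q, hdeg, hev, hcoeff⟩ := exists_poly_sahiE_update p e U hU0 hU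
  have hQ : Q = 0 := by
    refine eq_zero_of_natDegree_lt_card_of_eval_eq_zero Q (gridPt_injective 1) (fun m => ?_) (by rw [Fintype.card_fin]; omega)
    rw [← hev]
    refine hzero _ fun i => ?_
    by_cases hi : i = e
    · subst hi; rw [update_self]; exact gridPt_mem_Ioo 1 m
    · rw [update_of_ne hi]; exact hp i
  rw [hQ, Polynomial.coeff_zero] at hcoeff
  have h := hcoeff.symm
  rw [topCoeff_one] at h
  -- translate the `e`-free expectations into expectations under `μ_p`
  have ig0 : Ignores e (ind (U 0)) := ignores_ind_of_forall_iff hU0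
  rw [← ex_eq_offEx p e ((ignores_ind_pivSet e _).mul ig0), ← ex_eq_offEx p e ((ignores_ind_pivSet e _).mul ig0),
    ← ex_eq_offEx p e (ignores_ind_pivSet e _), ← ex_eq_offEx p e (ignores_ind_pivSet e _), ← ex_eq_offEx p e ig0] at h
  linear_combination -h

/-- **THE RIGIDITY DETECTOR FOR TRIPLES.**  Let `U_0, U_1, U_2` be increasing events with `U_0` `e`-free, nonempty and not sure, and `e` pivotal
for `U_1` and for `U_2`.  If some coordinate is essential for both `Piv_e U_1` and `U_0`, and `Piv_e U_1 ∩ U_0 ≠ ∅`, then `E_3(μ_p; 1_U) ≠ 0` for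
some interior `p` (THEOREM R₃: the `p_e²`-coefficient cannot vanish identically). [this work] -/
theorem exists_interior_sahiE_three_ne_zero_of_witness (U : Fin 3 → Set (Set ι)) (e : ι) (hU0 : ∀ ω, insert e ω ∈ U 0 ↔ ω ∈ U 0)
    (hU0up : IsUpperSet (U 0)) (hU0ne : (U 0).Nonempty) (hU0ns : (∅ : Set ι) ∉ U 0) (hU : ∀ j : Fin 2, IsUpperSet (U j.succ))
    (hpiv1 : (pivSet e (U 1)).Nonempty) (hpiv2 : (pivSet e (U 2)).Nonempty)
    (hy : ∃ y, ¬ Ignores y (ind (pivSet e (U 1))) ∧ ¬ Ignores y (ind (U 0))) (hmeet : (pivSet e (U 1) ∩ U 0).Nonempty) :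
    ∃ p : ι → unitInterval, (∀ i, (p i : ℝ) ∈ Set.Ioo (0 : ℝ) 1) ∧ sahiE (bernoulliWeight p) 3 (fun j => ind (U j)) ≠ 0 := by
  by_contra hall
  push Not at hall
  have hI := identity_of_forall_sahiE_three_eq_zero U e hU0 hU hall
  rcases rigidity_three hpiv1 hpiv2 hU0up hU0ne hU0ns hI with ⟨h1, -⟩ | ⟨-, h2⟩
  · obtain ⟨y, hy1, hy0⟩ := hy
    exact (h1 y).elim hy1 hy0
  · exact hmeet.ne_empty h2

end TriangleDetector

end Summit.CriticalPhenomena.PercolationContinuityZ3.Theorems
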